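import Mathlib
import Summits.KontsevichZagierPeriods.Zeta5Search.WedgeDictionaryWideSteps
import Summits.KontsevichZagierPeriods.Zeta5Search.ExplicitPQWideTransport
import HarnessLib

/-!
# `Σ₇`-sorting of a wide point and the combinatorics of its bad pairs (cell `pub-zeta5`, seat ct-1 g23)

HONEST FRAMING: systematic search; no irrationality claim unless certified.  Elementary combinatorics of Brown–Zudilin's
convergence cone in dual coordinates; nothing is evaluated, nothing about `ζ(5)`; no `def`, no new node.

For the wide induction of `wedgeDictionaryFull` (ct-1 g23, INBOX l.9031) the target is normalised by a slot permutation
`σ ∈ Σ₇` (`slotPerm`, transport of `ExplicitPQAt` by `ExplicitPQWideTransport`): the dual slots are SORTED so that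
`b₇ ≥ b₁ ≥ b₂ ≥ b₆ ≥ b₃ ≥ b₄ ≥ b₅` — the maximum on slot `7`, the next two values on its two path-neighbours `1, 2`
(the non-edge graph `{16,17,27,35,45,46}` is the path `3-5-4-6-1-7-2`).

* `exists_sorting` — such a `σ` exists (`Tuple.sort`);
* `triangle_free`, `claw_free` — in the convergence cone no three slots have pairwise sums `> b₀`, and no slot has three partners with
  sums `> b₀` (the fifteen edge pairs have sums `≤ b₀`, `converges_iff_bcoords`; the path has no triangle and maximal degree `2`);
* `sorted_converges` — hence the sorted arrangement of a convergent point with `b ≥ 0` is again convergent (its only possibly bad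
  pairs `(7,1)`, `(7,2)` are path edges), with `b₁ + b₂ ≤ b₀` and `b₆ + b₇ ≤ b₀`.
-/

noncomputable section

open Finset

namespace Summit.KontsevichZagierPeriods.Zeta5Search.WedgeDictionaryWideSorting

open Summit.KontsevichZagierPeriods.Zeta5Search.WedgeDictionary
open Summit.KontsevichZagierPeriods.Zeta5Search.WedgeDictionaryWideSteps (converges_iff_bcoords)
open Summit.KontsevichZagierPeriods.Zeta5Search.CellStarPencilDischarge (bOfA_slotPerm)
open Summit.KontsevichZagierPeriods.Zeta5Search.SymmetricGauge (permLower permLower_apply_succ permLower_zero)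
open Literature.NumberTheory.Irrationality.BrownZudilin2022 (bOfA Converges slotPerm)

/-! ## 1. Sorting by a slot permutation -/

/-- **A sorting permutation exists**: for every `a` there is `σ ∈ Σ₇` with
`b₇ ≥ b₁ ≥ b₂ ≥ b₆ ≥ b₃ ≥ b₄ ≥ b₅` at `b = b(σ·a)` (`Tuple.sort` composed with a fixed relabelling). [folklore] -/
theorem exists_sorting (a : Fin 8 → ℤ) : ∃ σ : Equiv.Perm (Fin 7),
    bOfA (slotPerm σ a) 1 ≤ bOfA (slotPerm σ a) 7 ∧ bOfA (slotPerm σ a) 2 ≤ bOfA (slotPerm σ a) 1 ∧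
    bOfA (slotPerm σ a) 6 ≤ bOfA (slotPerm σ a) 2 ∧ bOfA (slotPerm σ a) 3 ≤ bOfA (slotPerm σ a) 6 ∧
    bOfA (slotPerm σ a) 4 ≤ bOfA (slotPerm σ a) 3 ∧ bOfA (slotPerm σ a) 5 ≤ bOfA (slotPerm σ a) 4 := by
  set f : Fin 7 → ℤ := fun i => bOfA a (i.val + 1) with hf
  set τ : Equiv.Perm (Fin 7) := Tuple.sort f with hτ
  have hmono : Monotone (f ∘ τ) := Tuple.monotone_sort f
  -- the fixed relabelling `π`: slot index `i` ↦ rank position (`4 ↦ 0, 3 ↦ 1, 2 ↦ 2, 5 ↦ 3, 1 ↦ 4, 0 ↦ 5, 6 ↦ 6`)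
  let π : Equiv.Perm (Fin 7) := ⟨![5, 4, 2, 1, 0, 3, 6], ![4, 3, 2, 5, 1, 0, 6], by decide, by decide⟩
  refine ⟨(π.trans τ).symm, ?_⟩
  have key : ∀ i : Fin 7, bOfA (slotPerm (π.trans τ).symm a) (i.val + 1) = f (τ (π i)) := by
    intro i
    rw [bOfA_slotPerm, permLower_apply_succ]
    rfl
  have k0 := key 0; have k1 := key 1; have k2 := key 2; have k3 := key 3; have k4 := key 4; have k5 := key 5
  have k6 := key 6
  simp only [Fin.isValue, Fin.val_zero, Fin.val_one, Fin.val_two, zero_add, Nat.reduceAdd, show (3 : Fin 7).val + 1 = 4 from rfl,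
    show (4 : Fin 7).val + 1 = 5 from rfl, show (5 : Fin 7).val + 1 = 6 from rfl, show (6 : Fin 7).val + 1 = 7 from rfl] at k0 k1 k2 k3 k4 k5 k6
  have e0 : π 0 = 5 := rfl
  have e1 : π 1 = 4 := rfl
  have e2 : π 2 = 2 := rfl
  have e3 : π 3 = 1 := rfl
  have e4 : π 4 = 0 := rfl
  have e5 : π 5 = 3 := rfl
  have e6 : π 6 = 6 := rfl
  rw [e0] at k0; rw [e1] at k1; rw [e2] at k2; rw [e3] at k3; rw [e4] at k4; rw [e5] at k5; rw [e6] at k6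
  have m : ∀ i j : Fin 7, i ≤ j → f (τ i) ≤ f (τ j) := fun i j hij => hmono hij
  rw [k0, k1, k2, k3, k4, k5, k6]
  exact ⟨m 5 6 (by decide), m 4 5 (by decide), m 3 4 (by decide), m 2 3 (by decide), m 1 2 (by decide), m 0 1 (by decide)⟩

/-! ## 2. No bad triangle, no bad claw -/

/-- **No bad triangle**: for a convergent `a` and three distinct slots `i, j, k ∈ [1,7]`, one of the three pair sums is `≤ b₀`
(the non-edge graph is a path, hence triangle-free; edge-pair sums are `≤ b₀`). [folklore] -/
theorem triangle_free {a : Fin 8 → ℤ} (hconv : Converges a) {i j k : ℕ} (hi : i ∈ Icc 1 7) (hj : j ∈ Icc 1 7)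
    (hk : k ∈ Icc 1 7) (hij : i ≠ j) (hik : i ≠ k) (hjk : j ≠ k) :
    bOfA a i + bOfA a j ≤ bOfA a 0 ∨ bOfA a i + bOfA a k ≤ bOfA a 0 ∨ bOfA a j + bOfA a k ≤ bOfA a 0 := by
  obtain ⟨-, -, p12, p13, p14, p15, p23, p24, p25, p26, p34, p36, p37, p47, p56, p57, p67⟩ :=
    (converges_iff_bcoords a).1 hconv
  obtain ⟨hi1, hi7⟩ := mem_Icc.1 hi
  obtain ⟨hj1, hj7⟩ := mem_Icc.1 hj
  obtain ⟨hk1, hk7⟩ := mem_Icc.1 hk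
  interval_cases i <;> interval_cases j <;> interval_cases k <;> omega

/-- The edge partners of each slot: for `i ∈ [1,7]` and `j ∉ {i} ∪ (non-edge partners of i)`, `b_i + b_j ≤ b₀`. [folklore] -/
theorem edge_partner {a : Fin 8 → ℤ} (hconv : Converges a) {i j : ℕ} (hi : i ∈ Icc 1 7) (hj : j ∈ Icc 1 7) (hij : j ≠ i)
    (h1 : j ≠ (if i = 1 then 6 else if i = 2 then 7 else if i = 3 then 5 else if i = 4 then 5 else if i = 5 then 3
      else if i = 6 then 1 else 1))
    (h2 : j ≠ (if i = 1 then 7 else if i = 2 then 7 else if i = 3 then 5 else if i = 4 then 6 else if i = 5 then 4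
      else if i = 6 then 4 else 2)) :
    bOfA a i + bOfA a j ≤ bOfA a 0 := by
  obtain ⟨-, -, p12, p13, p14, p15, p23, p24, p25, p26, p34, p36, p37, p47, p56, p57, p67⟩ :=
    (converges_iff_bcoords a).1 hconv
  obtain ⟨hi1, hi7⟩ := mem_Icc.1 hi
  obtain ⟨hj1, hj7⟩ := mem_Icc.1 hj
  interval_cases i <;> interval_cases j <;> simp at hij h1 h2 <;> omega

/-- **No bad claw**: for a convergent `a`, a slot `i` and three distinct other slots `j, k, l`, one of `b_i + b_j`, `b_i + b_k`,
`b_i + b_l` is `≤ b₀` (every slot has at most two non-edge partners). [folklore] -/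
theorem claw_free {a : Fin 8 → ℤ} (hconv : Converges a) {i j k l : ℕ} (hi : i ∈ Icc 1 7) (hj : j ∈ Icc 1 7)
    (hk : k ∈ Icc 1 7) (hl : l ∈ Icc 1 7) (hij : j ≠ i) (hik : k ≠ i) (hil : l ≠ i) (hjk : j ≠ k) (hjl : j ≠ l)
    (hkl : k ≠ l) :
    bOfA a i + bOfA a j ≤ bOfA a 0 ∨ bOfA a i + bOfA a k ≤ bOfA a 0 ∨ bOfA a i + bOfA a l ≤ bOfA a 0 := by
  set n₁ := (if i = 1 then 6 else if i = 2 then 7 else if i = 3 then 5 else if i = 4 then 5 else if i = 5 then 3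
      else if i = 6 then 1 else 1) with hn₁
  set n₂ := (if i = 1 then 7 else if i = 2 then 7 else if i = 3 then 5 else if i = 4 then 6 else if i = 5 then 4
      else if i = 6 then 4 else 2) with hn₂
  by_cases cj : j ≠ n₁ ∧ j ≠ n₂
  · exact Or.inl (edge_partner hconv hi hj hij cj.1 cj.2)
  by_cases ck : k ≠ n₁ ∧ k ≠ n₂
  · exact Or.inr (Or.inl (edge_partner hconv hi hk hik ck.1 ck.2))
  have cl : l ≠ n₁ ∧ l ≠ n₂ := by
    push Not at cj ck
    constructor
    · intro h
      by_cases hj1 : j = n₁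
      · exact hjl (hj1.trans h.symm)
      · have hj2 := cj hj1
        by_cases hk1 : k = n₁
        · exact hkl (hk1.trans h.symm)
        · exact hjk (hj2.trans (ck hk1).symm)
    · intro h
      by_cases hj1 : j = n₁
      · by_cases hk1 : k = n₁
        · exact hjk (hj1.trans hk1.symm)
        · exact hkl ((ck hk1).trans h.symm)
      · exact hjl ((cj hj1).trans h.symm)
  exact Or.inr (Or.inr (edge_partner hconv hi hl hil cl.1 cl.2))

/-! ## 3. The sorted arrangement is convergent -/

/-- **The sorted arrangement of a convergent point is convergent.**  If `a` is convergent with `b(a) ≥ 0` and `σ` sorts the dual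
slots (`b₇ ≥ b₁ ≥ b₂ ≥ b₆ ≥ b₃ ≥ b₄ ≥ b₅` at `σ·a`), then `σ·a` is convergent, and moreover `b₁ + b₂ ≤ b₀`, `b₆ + b₇ ≤ b₀` there
(`triangle_free` and `claw_free` at the pre-images of the slots `7, 1, 2, 6`). [folklore] -/
theorem sorted_converges {a : Fin 8 → ℤ} (hconv : Converges a) (hnn : ∀ m ∈ Icc 1 7, 0 ≤ bOfA a m) (σ : Equiv.Perm (Fin 7))
    (h17 : bOfA (slotPerm σ a) 1 ≤ bOfA (slotPerm σ a) 7) (h21 : bOfA (slotPerm σ a) 2 ≤ bOfA (slotPerm σ a) 1)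
    (h62 : bOfA (slotPerm σ a) 6 ≤ bOfA (slotPerm σ a) 2) (h36 : bOfA (slotPerm σ a) 3 ≤ bOfA (slotPerm σ a) 6)
    (h43 : bOfA (slotPerm σ a) 4 ≤ bOfA (slotPerm σ a) 3) (h54 : bOfA (slotPerm σ a) 5 ≤ bOfA (slotPerm σ a) 4) :
    Converges (slotPerm σ a) ∧ bOfA (slotPerm σ a) 1 + bOfA (slotPerm σ a) 2 ≤ bOfA (slotPerm σ a) 0 ∧
      bOfA (slotPerm σ a) 6 + bOfA (slotPerm σ a) 7 ≤ bOfA (slotPerm σ a) 0 := by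
  -- the values of `σ·a` are values of `a` at the distinct slots `s_i = σ⁻¹(i-1) + 1`
  have hv : ∀ i : Fin 7, bOfA (slotPerm σ a) (i.val + 1) = bOfA a ((σ⁻¹ i).val + 1) := fun i => by
    rw [bOfA_slotPerm, permLower_apply_succ]
  have h0 : bOfA (slotPerm σ a) 0 = bOfA a 0 := by rw [bOfA_slotPerm, permLower_zero]
  have v1 := hv 0; have v2 := hv 1; have v3 := hv 2; have v4 := hv 3; have v5 := hv 4; have v6 := hv 5; have v7 := hv 6
  simp only [Fin.isValue, Fin.val_zero, Fin.val_one, Fin.val_two, zero_add, Nat.reduceAdd, show (3 : Fin 7).val + 1 = 4 from rfl,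
    show (4 : Fin 7).val + 1 = 5 from rfl, show (5 : Fin 7).val + 1 = 6 from rfl, show (6 : Fin 7).val + 1 = 7 from rfl]
    at v1 v2 v3 v4 v5 v6 v7
  have mem : ∀ i : Fin 7, (σ⁻¹ i).val + 1 ∈ Icc 1 7 := fun i => by have := (σ⁻¹ i).isLt; simp only [mem_Icc]; omega
  have ne : ∀ i j : Fin 7, i ≠ j → (σ⁻¹ i).val + 1 ≠ (σ⁻¹ j).val + 1 := fun i j hij h => by
    apply hij
    have : (σ⁻¹ i).val = (σ⁻¹ j).val := by omega
    exact σ⁻¹.injective (Fin.ext this)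
  -- `b₁ + b₂ ≤ b₀` from the triangle at the slots of `7, 1, 2`
  have P12 : bOfA (slotPerm σ a) 1 + bOfA (slotPerm σ a) 2 ≤ bOfA (slotPerm σ a) 0 := by
    have t := triangle_free hconv (mem 6) (mem 0) (mem 1) (ne 6 0 (by decide)) (ne 6 1 (by decide)) (ne 0 1 (by decide))
    rw [← v7, ← v1, ← v2, ← h0] at t
    omega
  -- `b₆ + b₇ ≤ b₀` from the claw at the slot of `7` with partners the slots of `1, 2, 6`
  have P76 : bOfA (slotPerm σ a) 6 + bOfA (slotPerm σ a) 7 ≤ bOfA (slotPerm σ a) 0 := by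
    have t := claw_free hconv (mem 6) (mem 0) (mem 1) (mem 5) (ne 0 6 (by decide)) (ne 1 6 (by decide)) (ne 5 6 (by decide))
      (ne 0 1 (by decide)) (ne 0 5 (by decide)) (ne 1 5 (by decide))
    rw [← v7, ← v1, ← v2, ← v6, ← h0] at t
    omega
  have n2 : 0 ≤ bOfA (slotPerm σ a) 2 := by rw [v2]; exact hnn _ (mem 1)
  have n3 : 0 ≤ bOfA (slotPerm σ a) 3 := by rw [v3]; exact hnn _ (mem 2)
  refine ⟨(converges_iff_bcoords _).2 ⟨n2, n3, ?_, ?_, ?_, ?_, ?_, ?_, ?_, ?_, ?_, ?_, ?_, ?_, ?_, ?_, ?_⟩, P12, P76⟩ <;> omega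

end Summit.KontsevichZagierPeriods.Zeta5Search.WedgeDictionaryWideSorting

end
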